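import Literature.NumberTheory.LFunctions.WeilTwoPrimeDeflL2Base
import Literature.NumberTheory.LFunctions.WeilBlockRowsPZ
import HarnessLib

/-!
# Deflated two-prime certificate L2: the factored even inverse agrees with `D`, rows 0–7

`WeilCert.checkDnRow` (even block) for certificate L2, by `decide +kernel`. Pure proof file.
-/

noncomputable section

namespace Literature.NumberTheory.LFunctions

set_option maxHeartbeats 0 in
/-- Row 0 of `DnE/LsE` is row 0 of the even `D` (certificate L2). [folklore] -/
theorem checkDnRow0_0_weilCertDeflL2 : weilCertDeflL2Base.checkDnRow weilCertDeflL2DnE weilCertDeflL2LsE 0 0 = true := by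
  decide +kernel

set_option maxHeartbeats 0 in
/-- Row 1 of `DnE/LsE` is row 1 of the even `D` (certificate L2). [folklore] -/
theorem checkDnRow0_1_weilCertDeflL2 : weilCertDeflL2Base.checkDnRow weilCertDeflL2DnE weilCertDeflL2LsE 0 1 = true := by
  decide +kernel

set_option maxHeartbeats 0 in
/-- Row 2 of `DnE/LsE` is row 2 of the even `D` (certificate L2). [folklore] -/
theorem checkDnRow0_2_weilCertDeflL2 : weilCertDeflL2Base.checkDnRow weilCertDeflL2DnE weilCertDeflL2LsE 0 2 = true := by
  decide +kernel

set_option maxHeartbeats 0 in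
/-- Row 3 of `DnE/LsE` is row 3 of the even `D` (certificate L2). [folklore] -/
theorem checkDnRow0_3_weilCertDeflL2 : weilCertDeflL2Base.checkDnRow weilCertDeflL2DnE weilCertDeflL2LsE 0 3 = true := by
  decide +kernel

set_option maxHeartbeats 0 in
/-- Row 4 of `DnE/LsE` is row 4 of the even `D` (certificate L2). [folklore] -/
theorem checkDnRow0_4_weilCertDeflL2 : weilCertDeflL2Base.checkDnRow weilCertDeflL2DnE weilCertDeflL2LsE 0 4 = true := by
  decide +kernel

set_option maxHeartbeats 0 in
/-- Row 5 of `DnE/LsE` is row 5 of the even `D` (certificate L2). [folklore] -/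
theorem checkDnRow0_5_weilCertDeflL2 : weilCertDeflL2Base.checkDnRow weilCertDeflL2DnE weilCertDeflL2LsE 0 5 = true := by
  decide +kernel

set_option maxHeartbeats 0 in
/-- Row 6 of `DnE/LsE` is row 6 of the even `D` (certificate L2). [folklore] -/
theorem checkDnRow0_6_weilCertDeflL2 : weilCertDeflL2Base.checkDnRow weilCertDeflL2DnE weilCertDeflL2LsE 0 6 = true := by
  decide +kernel

set_option maxHeartbeats 0 in
/-- Row 7 of `DnE/LsE` is row 7 of the even `D` (certificate L2). [folklore] -/
theorem checkDnRow0_7_weilCertDeflL2 : weilCertDeflL2Base.checkDnRow weilCertDeflL2DnE weilCertDeflL2LsE 0 7 = true := by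
  decide +kernel


end Literature.NumberTheory.LFunctions
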